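import Literature.Geometry.Riemannian.CalabiMinimalGeodesicCutLocus
import Literature.Geometry.Riemannian.DistanceLaplacianComparisonRadial
import Literature.Geometry.Lorentzian.HessianLinear
import HarnessLib

/-!
# The barrier maximum principle (Calabi 1958; Cheeger–Colding 1996, §1)

The maximum principle in the form used throughout the Cheeger–Colding theory
(Cheeger–Colding 1996, §1: Laplacian comparison "in the barrier sense" for distance functions
and their sums, compared with comparison functions `G(r)`): a function `u` admitting, at every
point and for every `ε > 0`, a `C²` UPPER BARRIER `φ` (`u - φ` locally maximal at the point,
`Δφ ≤ F + ε`) dominates every viscosity subsolution `w` of `Δw ≥ G` with `G > F`, once it does so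
on the boundary. We PROVE:

* `le_of_upper_barriers` — the principle, on a compact `K` with an open `Ω ⊆ K`;
* `upper_barriers_add` — upper barriers for `u₁`, `u₂` (bounds `F₁`, `F₂`) add to upper barriers
  for `u₁ + u₂` (bound `F₁ + F₂`; `dalembertian_add_of_contMDiffAt`), the case of the excess
  function `d(p, ·) + d(q, ·) - d(p, q)` of Abresch–Gromoll;
* `upper_barriers_edist` — **Calabi's barriers**: under `Ric ≥ -(m-1) g` the distance function
  `d(p, ·)` admits at every `x ≠ p` and for every `ε > 0` a `C²` upper barrier with
  `Δφ(x) ≤ (m-1) coth d(p, x) + ε` (`exists_smooth_upper_barrier_edist` with the base point moved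
  to `γ(δ)`, `δ → 0`, continuity of `coth`).

The matching subsolution property of `w = G ∘ d(y, ·)`, `G` nonincreasing, is
`le_laplaceBeltrami_comp_edist_of_antitone` (`DistanceLaplacianComparisonRadial.lean`).
No definitions, no named facts (D-0026). Groundwork for `CheegerColding1997_sphereStability`.

## References

* E. Calabi, Duke Math. J. 25 (1958) 45–56. [Calabi1958]
* J. Cheeger, T. H. Colding, Ann. of Math. 144 (1996) 189–237, §1. [CheegerColding1996]
* P. Petersen, *Riemannian Geometry*, 3rd ed. (2016), Lemma 7.1.9, §7.1.3. [Petersen2016]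
-/

noncomputable section

open Bundle Set Function Filter
open scoped Manifold ContDiff Topology ENNReal NNReal Real

namespace Literature.Geometry.Riemannian

open Lorentzian Lorentzian.PseudoRiemannianMetric

/-! ### §1 The principle -/

section Principle

variable {E : Type*} [NormedAddCommGroup E] [NormedSpace ℝ E] {H : Type*} [TopologicalSpace H]
  {I : ModelWithCorners ℝ E H} {M : Type*} [TopologicalSpace M] [ChartedSpace H M]
  [IsManifold I ∞ M] [FiniteDimensional ℝ E]
  (g : PseudoRiemannianMetric I ∞ E (TangentSpace I : M → Type _))

/-- **The barrier maximum principle** (Calabi 1958; Cheeger–Colding 1996, §1). Let `K` be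
compact, `Ω ⊆ K` open, `w - u` upper semicontinuous on `K` with `w ≤ u` on `K ∖ Ω`. Suppose
that at every `x ∈ Ω`: (i) for every `ε > 0`, `u` has a `C²` upper barrier `φ` at `x` —
`u - φ` has a local maximum at `x` and `Δ_g φ(x) ≤ F(x) + ε`; (ii) `w` is a viscosity
subsolution of `Δ w ≥ G`: every `C²` function `φ` with `w - φ` locally maximal at `x` has
`G(x) ≤ Δ_g φ(x)`; (iii) `F(x) < G(x)`. Then `w ≤ u` on `K`. (At a positive maximum `x₀ ∈ Ω` of
`w - u` on `K`, an upper barrier `φ` of `u` with `ε = (G - F)(x₀)/2` is an upper test function of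
`w`.) [cite: CheegerColding1996, §1] [cite: Calabi1958] -/
theorem le_of_upper_barriers {K Ω : Set M} (hK : IsCompact K) (hΩK : Ω ⊆ K) (hΩ : IsOpen Ω)
    {u w F G : M → ℝ} (husc : UpperSemicontinuousOn (fun x ↦ w x - u x) K)
    (hbdry : ∀ x ∈ K \ Ω, w x ≤ u x)
    (hu : ∀ x ∈ Ω, ∀ ε > 0, ∃ φ : M → ℝ, (∀ᶠ x' in 𝓝 x, ContMDiffAt I 𝓘(ℝ, ℝ) 2 φ x') ∧
      IsLocalMax (fun x' ↦ u x' - φ x') x ∧ g.laplaceBeltrami φ x ≤ F x + ε)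
    (hw : ∀ x ∈ Ω, ∀ φ : M → ℝ, (∀ᶠ x' in 𝓝 x, ContMDiffAt I 𝓘(ℝ, ℝ) 2 φ x') →
      IsLocalMax (fun x' ↦ w x' - φ x') x → G x ≤ g.laplaceBeltrami φ x)
    (hFG : ∀ x ∈ Ω, F x < G x) :
    ∀ x ∈ K, w x ≤ u x := by
  by_contra hcon
  simp only [not_forall, not_le, exists_prop] at hcon
  obtain ⟨x₁, hx₁K, hx₁⟩ := hcon
  obtain ⟨x₀, hx₀K, hmax⟩ := husc.exists_isMaxOn ⟨x₁, hx₁K⟩ hK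
  have hpos : 0 < w x₀ - u x₀ := lt_of_lt_of_le (by linarith) (hmax hx₁K)
  have hx₀Ω : x₀ ∈ Ω := by
    by_contra h
    have := hbdry x₀ ⟨hx₀K, h⟩
    linarith
  obtain ⟨φ, hφ, hφmax, hΔφ⟩ := hu x₀ hx₀Ω ((G x₀ - F x₀) / 2) (by linarith [hFG x₀ hx₀Ω])
  have hloc : IsLocalMax (fun x' ↦ w x' - φ x') x₀ := by
    filter_upwards [hΩ.mem_nhds hx₀Ω, hφmax] with x' hx' hφx'
    have h1 : w x' - u x' ≤ w x₀ - u x₀ := hmax (hΩK hx')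
    have h2 : u x' - φ x' ≤ u x₀ - φ x₀ := hφx'
    linarith
  have h := hw x₀ hx₀Ω φ hφ hloc
  linarith [hFG x₀ hx₀Ω]

/-- **Upper barriers add**: if `u₁` and `u₂` have `C²` upper barriers at `x` with Laplacian
bounds `F₁(x) + ε`, `F₂(x) + ε` for every `ε > 0`, then so does `u₁ + u₂` with the bound
`F₁(x) + F₂(x) + ε` (`Δ(φ₁ + φ₂) = Δφ₁ + Δφ₂`, `dalembertian_add_of_contMDiffAt`) — e.g. the
excess function `e = d(p, ·) + d(q, ·) - d(p, q)` (Abresch–Gromoll; Cheeger–Colding 1996, §1).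
[cite: CheegerColding1996, §1] -/
theorem upper_barriers_add [g.HasLeviCivita] {u₁ u₂ F₁ F₂ : M → ℝ} {x : M}
    (h₁ : ∀ ε > 0, ∃ φ : M → ℝ, (∀ᶠ x' in 𝓝 x, ContMDiffAt I 𝓘(ℝ, ℝ) 2 φ x') ∧
      IsLocalMax (fun x' ↦ u₁ x' - φ x') x ∧ g.laplaceBeltrami φ x ≤ F₁ x + ε)
    (h₂ : ∀ ε > 0, ∃ φ : M → ℝ, (∀ᶠ x' in 𝓝 x, ContMDiffAt I 𝓘(ℝ, ℝ) 2 φ x') ∧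
      IsLocalMax (fun x' ↦ u₂ x' - φ x') x ∧ g.laplaceBeltrami φ x ≤ F₂ x + ε) :
    ∀ ε > 0, ∃ φ : M → ℝ, (∀ᶠ x' in 𝓝 x, ContMDiffAt I 𝓘(ℝ, ℝ) 2 φ x') ∧
      IsLocalMax (fun x' ↦ (u₁ x' + u₂ x') - φ x') x ∧
        g.laplaceBeltrami φ x ≤ (F₁ x + F₂ x) + ε := by
  intro ε hε
  obtain ⟨φ₁, hφ₁, hmax₁, hΔ₁⟩ := h₁ (ε / 2) (half_pos hε)
  obtain ⟨φ₂, hφ₂, hmax₂, hΔ₂⟩ := h₂ (ε / 2) (half_pos hε)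
  refine ⟨fun x' ↦ φ₁ x' + φ₂ x', ?_, ?_, ?_⟩
  · filter_upwards [hφ₁, hφ₂] with x' h1 h2 using h1.add h2
  · filter_upwards [hmax₁, hmax₂] with x' h1 h2
    have h1' : u₁ x' - φ₁ x' ≤ u₁ x - φ₁ x := h1
    have h2' : u₂ x' - φ₂ x' ≤ u₂ x - φ₂ x := h2
    show (u₁ x' + u₂ x') - (φ₁ x' + φ₂ x') ≤ (u₁ x + u₂ x) - (φ₁ x + φ₂ x)
    linarith
  · have hadd : g.laplaceBeltrami (fun x' ↦ φ₁ x' + φ₂ x') x =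
        g.laplaceBeltrami φ₁ x + g.laplaceBeltrami φ₂ x := by
      rw [laplaceBeltrami_eq_dalembertian, laplaceBeltrami_eq_dalembertian,
        laplaceBeltrami_eq_dalembertian]
      exact dalembertian_add_of_contMDiffAt g hφ₁.self_of_nhds hφ₂.self_of_nhds
    rw [hadd]
    linarith

end Principle

/-! ### §2 Calabi's barriers for the distance function, with the sharp Laplacian bound -/

section Distance

variable {E : Type*} [NormedAddCommGroup E] [NormedSpace ℝ E] [FiniteDimensional ℝ E]
  [CompleteSpace E] {M : Type*} [TopologicalSpace M] [ChartedSpace E M] [IsManifold 𝓘(ℝ, E) ∞ M]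
  [T2Space M]
  (g : PseudoRiemannianMetric 𝓘(ℝ, E) ∞ E (TangentSpace 𝓘(ℝ, E) : M → Type _)) [g.HasLeviCivita]
  [CovariantDerivative.ContMDiffCovariantDerivative g.leviCivita 1]
  [CovariantDerivative.ContMDiffCovariantDerivative g.leviCivita ∞]

/-- `coth` is continuous at positive arguments: for `T > 0` and `η > 0` there is `δ ∈ (0, T)`
with `coth(T - δ) ≤ coth T + η`. [folklore] -/
theorem exists_coth_sub_le {T η : ℝ} (hT : 0 < T) (hη : 0 < η) :
    ∃ δ : ℝ, 0 < δ ∧ δ < T ∧ Real.cosh (T - δ) / Real.sinh (T - δ) ≤ Real.cosh T / Real.sinh T + η := by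
  have hcont : ContinuousAt (fun s : ℝ ↦ Real.cosh s / Real.sinh s) T :=
    (Real.continuous_cosh.continuousAt).div Real.continuous_sinh.continuousAt
      (Real.sinh_pos_iff.2 hT).ne'
  have hev : ∀ᶠ s in 𝓝 T, Real.cosh s / Real.sinh s < Real.cosh T / Real.sinh T + η :=
    hcont.eventually (gt_mem_nhds (by linarith))
  obtain ⟨r, hr, hball⟩ := Metric.eventually_nhds_iff.1 hev
  refine ⟨min (r / 2) (T / 2), lt_min (half_pos hr) (half_pos hT),
    (min_le_right _ _).trans_lt (half_lt_self hT), (hball ?_).le⟩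
  rw [Real.dist_eq, show T - min (r / 2) (T / 2) - T = -min (r / 2) (T / 2) by ring, abs_neg,
    abs_of_pos (lt_min (half_pos hr) (half_pos hT))]
  exact (min_le_left _ _).trans_lt (half_lt_self hr)

/-- **Calabi's upper barriers for `d(p, ·)` with the sharp bound** (Calabi 1958; Cheeger–Colding
1996, §1: "`Δr ≤ (n-1) coth r` in the barrier sense"): on a connected Riemannian `m`-manifold with
complete Levi-Civita connection and `Ric ≥ -(m-1) g`, at every `x ≠ p` and for every `ε > 0`
there is `φ`, `C²` near `x`, with `d(p, ·) - φ` locally maximal at `x` and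
`Δ_g φ(x) ≤ (m-1) coth d(p, x) + ε` (namely `φ = d(γ(δ), ·)` for `δ` small,
`exists_smooth_upper_barrier_edist`, `exists_coth_sub_le`).
[cite: Calabi1958] [cite: CheegerColding1996, §1] -/
theorem upper_barriers_edist [ConnectedSpace M] (hg : g.IsRiemannian)
    (hc : IsGeodesicallyComplete g.leviCivita)
    (hRic : ∀ (x : M) (w : TangentSpace 𝓘(ℝ, E) x),
      -((Module.finrank ℝ E : ℝ) - 1) * g.val x w w ≤ g.leviCivita.ricci x w w)
    {p x : M} (hxp : x ≠ p) :
    ∀ ε > 0, ∃ φ : M → ℝ, (∀ᶠ x' in 𝓝 x, ContMDiffAt 𝓘(ℝ, E) 𝓘(ℝ, ℝ) 2 φ x') ∧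
      IsLocalMax (fun x' ↦ (g.edist hg p x').toReal - φ x') x ∧
        g.laplaceBeltrami φ x ≤ ((Module.finrank ℝ E : ℝ) - 1) *
          (Real.cosh (g.edist hg p x).toReal / Real.sinh (g.edist hg p x).toReal) + ε := by
  intro ε hε
  haveI : LocallyCompactSpace M := Manifold.locallyCompact_of_finiteDimensional 𝓘(ℝ, E)
  haveI : RegularSpace M := inferInstance
  haveI : T3Space M := inferInstance
  set T : ℝ := (g.edist hg p x).toReal with hT_def
  have hT : 0 < T := by
    refine ENNReal.toReal_pos (fun h0 ↦ hxp ?_) (edist_ne_top hg p x)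
    exact ((edist_eq_zero_iff hg).1 h0).symm
  -- the dimension factor `m - 1 ≥ 0` (`E` is nontrivial: there is a `g_p`-unit vector)
  have hm : (0 : ℝ) ≤ (Module.finrank ℝ E : ℝ) - 1 := by
    obtain ⟨u₀, -, hu₀, -, -, -⟩ := exists_unit_speed_expMap_eq_of_ne g hg hc hxp
    have hu₀0 : (u₀ : E) ≠ 0 := fun h ↦ by
      rw [h, map_zero] at hu₀
      exact zero_ne_one hu₀
    have h1 : 0 < Module.finrank ℝ E := Module.finrank_pos_iff_exists_ne_zero.2 ⟨u₀, hu₀0⟩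
    have : (1 : ℝ) ≤ (Module.finrank ℝ E : ℝ) := by exact_mod_cast h1
    linarith
  -- move the base point to `γ(δ)` with `(m-1)(coth(T-δ) - coth T) ≤ ε`
  set η : ℝ := ε / (((Module.finrank ℝ E : ℝ) - 1) + 1) with hη_def
  have hη : 0 < η := div_pos hε (by linarith)
  have hmη : ((Module.finrank ℝ E : ℝ) - 1) * η ≤ ε := by
    have h1 : (((Module.finrank ℝ E : ℝ) - 1) + 1) * η = ε := by
      rw [hη_def]; exact mul_div_cancel₀ ε (by linarith)
    nlinarith
  obtain ⟨δ, hδ, hδT, hcoth⟩ := exists_coth_sub_le hT hη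
  obtain ⟨q, -, hqx, htri, hsmooth, hΔ⟩ := exists_smooth_upper_barrier_edist g hg hc hRic hxp hδ hδT
  refine ⟨fun z ↦ (g.edist hg q z).toReal, eventually_contMDiffAt_two_of_contMDiffAt hsmooth, ?_, ?_⟩
  · -- `d(p, ·) - d(q, ·) ≤ δ` everywhere, `= δ` at `x`
    refine Filter.Eventually.of_forall fun z ↦ ?_
    have h1 : (g.edist hg p z).toReal ≤ δ + (g.edist hg q z).toReal := by
      have h := htri z
      have h2 : (g.edist hg p z).toReal ≤ (ENNReal.ofReal δ + g.edist hg q z).toReal :=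
        ENNReal.toReal_mono (ENNReal.add_ne_top.2 ⟨ENNReal.ofReal_ne_top, edist_ne_top hg q z⟩) h
      rwa [ENNReal.toReal_add ENNReal.ofReal_ne_top (edist_ne_top hg q z),
        ENNReal.toReal_ofReal hδ.le] at h2
    have h2 : (g.edist hg q x).toReal = T - δ := by
      rw [hqx, ENNReal.toReal_ofReal (by linarith)]
    show (g.edist hg p z).toReal - (g.edist hg q z).toReal ≤
      (g.edist hg p x).toReal - (g.edist hg q x).toReal
    rw [h2, ← hT_def]
    linarith
  · calc g.laplaceBeltrami (fun z ↦ (g.edist hg q z).toReal) x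
        ≤ ((Module.finrank ℝ E : ℝ) - 1) * (Real.cosh (T - δ) / Real.sinh (T - δ)) := hΔ
      _ ≤ ((Module.finrank ℝ E : ℝ) - 1) * (Real.cosh T / Real.sinh T + η) :=
          mul_le_mul_of_nonneg_left hcoth hm
      _ ≤ ((Module.finrank ℝ E : ℝ) - 1) * (Real.cosh T / Real.sinh T) + ε := by nlinarith

end Distance

end Literature.Geometry.Riemannian

end
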